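import Literature.Analysis.Complex.VerticalLineShift
import Literature.Analysis.Complex.VerticalLineShiftPoles
import Literature.NumberTheory.LFunctions.HuxleyZeroDetection
import Mathlib.Analysis.SpecialFunctions.Gaussian.GaussianIntegral
import HarnessLib

/-!
# Gaussian-damped vertical line integrals `∫ h(u) e^{u²} y^{-u} u^{-k} du` (kernel machinery for
# the Conrey–Iwaniec approximate functional equation)

Topic `Literature/NumberTheory/LFunctions`, support file for the kernel bounds (Lemma 7.2 / 7.4) of
B. Conrey, H. Iwaniec, *Spacing of zeros of Hecke L-functions and the class number problem*,
Acta Arith. 103 (2002), §7 [cite: ConreyIwaniec2002, §7 (7.9)–(7.17)], in the typed form used by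
the cell `landau-siegel/ls-inputs` (test function `G(u) = e^{u²}` on vertical lines, where
`|G(c+iv)| = e^{c²−v²}`). Everything here is PROVED; no definitions, no named facts.

For a "numerator" `h : ℂ → ℂ` (in the application `h(u) = Γ(w+u)/Γ(w)` or a divided difference of
it in `w`) of **Stirling class** on a strip — `‖h(u)‖ ≤ M (1+|Im u|)^n e^{π|Im u|/2}` — the integrands
`F_k(u) = h(u) e^{u²} y^{−u} u^{−k}` (`k = 0, 1`, `y > 0`) are dominated on the line `Re u = c` by the
Gaussian `M e^{c² + (n+2)²/2} y^{−c} |c|^{−k} e^{−v²/2}` (`poly_exp_mul_gauss_le`). Hence: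

* `integrable_lineF`, `norm_integral_lineF_le` — absolute convergence and the bound
  `‖∫ F_k(c+iv) dv‖ ≤ M e^{c²+(n+2)²/2} √(2π) · y^{−c} / |c|^k`;
* `integral_lineF_eq_of_noPole` — shifting the line across a strip `a ≤ Re u ≤ b` on which `h` is
  holomorphic (and `0 ∉ [a,b]` if `k ≠ 0`): the tree's
  `Literature.Analysis.Complex.integral_vertical_eq_of_differentiableOn`;
* `integral_lineF_one_sub_eq` — for `k = 1` and `a < 0 < b` the shift picks up the residue at the
  simple pole `u = 0`: `∫ F₁(b+iv) dv − ∫ F₁(a+iv) dv = 2π h(0)` (the tree's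
  `HuxleyZeroDetection.integral_vertical_sub_eq_of_pole`).

These are the two moves of the proof of [ConreyIwaniec2002, Lemma 7.2]: "moving the integration
in (7.14) to the line `Re u = A`", resp. "to the line `Re u = −1/4` ... the simple pole at `u = 0`
contributes the residue `1`".
-/

noncomputable section

open Complex MeasureTheory Real Set Filter
open scoped Topology

namespace Literature.NumberTheory.LFunctions

namespace ConreyIwaniec2002

namespace AFEKernel

/-! ### Norms on the line `u = c + iv` -/

/-- `‖e^{u²}‖ = e^{(Re u)² − (Im u)²}`. [folklore] -/
private theorem norm_cexp_sq (u : ℂ) : ‖cexp (u ^ 2)‖ = Real.exp (u.re ^ 2 - u.im ^ 2) := by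
  rw [Complex.norm_exp]
  congr 1
  rw [sq, Complex.mul_re]
  ring

/-- `‖y^{−u}‖ = y^{−Re u}` for `y > 0`. [folklore] -/
private theorem norm_cpow_neg {y : ℝ} (hy : 0 < y) (u : ℂ) : ‖(y : ℂ) ^ (-u)‖ = y ^ (-u.re) := by
  rw [Complex.norm_cpow_eq_rpow_re_of_pos hy, Complex.neg_re]

/-- `(1 + |v|)^n ≤ e^{n|v|}`. [folklore] -/
private theorem one_add_abs_pow_le_exp (n : ℕ) (v : ℝ) : (1 + |v|) ^ n ≤ Real.exp (n * |v|) := by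
  have h := Real.add_one_le_exp |v|
  calc (1 + |v|) ^ n ≤ (Real.exp |v|) ^ n := by
        apply pow_le_pow_left₀ (by positivity) (by linarith)
    _ = Real.exp (n * |v|) := by rw [← Real.exp_nat_mul]

/-- **The Gaussian majorant**: `(1+|v|)^n e^{π|v|/2} e^{c²−v²} ≤ e^{c² + (n+2)²/2} e^{−v²/2}`.
[folklore] -/
private theorem poly_exp_mul_gauss_le (n : ℕ) (c v : ℝ) :
    (1 + |v|) ^ n * Real.exp (π * |v| / 2) * Real.exp (c ^ 2 - v ^ 2) ≤
      Real.exp (c ^ 2 + ((n : ℝ) + 2) ^ 2 / 2) * Real.exp (-(v ^ 2 / 2)) := by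
  have h1 := one_add_abs_pow_le_exp n v
  have hπ : π * |v| / 2 ≤ 2 * |v| := by nlinarith [Real.pi_lt_four, abs_nonneg v]
  have hkey : (n : ℝ) * |v| + 2 * |v| + (c ^ 2 - v ^ 2) ≤
      c ^ 2 + ((n : ℝ) + 2) ^ 2 / 2 + -(v ^ 2 / 2) := by
    nlinarith [sq_nonneg ((n : ℝ) + 2 - |v|), sq_abs v]
  calc (1 + |v|) ^ n * Real.exp (π * |v| / 2) * Real.exp (c ^ 2 - v ^ 2)
      ≤ Real.exp (n * |v|) * Real.exp (2 * |v|) * Real.exp (c ^ 2 - v ^ 2) := by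
        gcongr
    _ = Real.exp ((n : ℝ) * |v| + 2 * |v| + (c ^ 2 - v ^ 2)) := by
        rw [← Real.exp_add, ← Real.exp_add]
    _ ≤ Real.exp (c ^ 2 + ((n : ℝ) + 2) ^ 2 / 2 + -(v ^ 2 / 2)) := Real.exp_le_exp.2 hkey
    _ = Real.exp (c ^ 2 + ((n : ℝ) + 2) ^ 2 / 2) * Real.exp (-(v ^ 2 / 2)) := by
        rw [Real.exp_add]

/-- The half-Gaussian `e^{−v²/2}` is integrable. [folklore] -/
private theorem integrable_exp_neg_sq_half : Integrable fun v : ℝ ↦ Real.exp (-(v ^ 2 / 2)) := by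
  have h := integrable_exp_neg_mul_sq (b := 1 / 2) (by norm_num)
  refine h.congr (Filter.Eventually.of_forall fun v ↦ ?_)
  simp only
  congr 1
  ring

/-- `∫ e^{−v²/2} dv = √(2π)`. [folklore] -/
private theorem integral_exp_neg_sq_half : ∫ v : ℝ, Real.exp (-(v ^ 2 / 2)) = Real.sqrt (2 * π) := by
  have h := integral_gaussian (1 / 2)
  have e : (fun v : ℝ ↦ Real.exp (-(v ^ 2 / 2))) = fun v : ℝ ↦ Real.exp (-(1 / 2) * v ^ 2) := by
    funext v; congr 1; ring
  rw [e, h]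
  congr 1
  field_simp

/-! ### The integrand `F_k(u) = h(u) e^{u²} y^{−u} / u^k` on a line: domination and integrability -/

/-- Pointwise Gaussian domination of `F_k(u) = h(u) e^{u²} y^{−u} u^{−k}` on the line `Re u = c`
(`k = 0` or `c ≠ 0`): `‖F_k(c+iv)‖ ≤ M e^{c²+(n+2)²/2} y^{−c} |c|^{−k} · e^{−v²/2}` — the integrand
estimate of the proof of Lemma 7.2 with `G(u) = e^{u²}`.
[cite: ConreyIwaniec2002, Lemma 7.2 (proof, integrand on Re u = c)] -/
theorem norm_lineF_le {h : ℂ → ℂ} {c M y : ℝ} {n k : ℕ} (hy : 0 < y) (hck : k = 0 ∨ c ≠ 0)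
    (hM : ∀ v : ℝ, ‖h ((c : ℂ) + v * I)‖ ≤ M * (1 + |v|) ^ n * Real.exp (π * |v| / 2)) (v : ℝ) :
    ‖h ((c : ℂ) + v * I) * cexp (((c : ℂ) + v * I) ^ 2) * (y : ℂ) ^ (-((c : ℂ) + v * I)) /
        ((c : ℂ) + v * I) ^ k‖ ≤
      M * Real.exp (c ^ 2 + ((n : ℝ) + 2) ^ 2 / 2) * y ^ (-c) / |c| ^ k *
        Real.exp (-(v ^ 2 / 2)) := by
  set u : ℂ := (c : ℂ) + v * I with hu
  have hure : u.re = c := by simp [hu]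
  have huim : u.im = v := by simp [hu]
  have hM0 : 0 ≤ M := by
    have := (norm_nonneg _).trans (hM 0)
    simpa using this
  have h1 : ‖h u * cexp (u ^ 2) * (y : ℂ) ^ (-u)‖ ≤
      M * Real.exp (c ^ 2 + ((n : ℝ) + 2) ^ 2 / 2) * Real.exp (-(v ^ 2 / 2)) * y ^ (-c) := by
    rw [norm_mul, norm_mul, norm_cexp_sq, norm_cpow_neg hy, hure, huim]
    have hg := poly_exp_mul_gauss_le n c v
    have hyc : 0 ≤ y ^ (-c) := (Real.rpow_pos_of_pos hy _).le
    calc ‖h u‖ * Real.exp (c ^ 2 - v ^ 2) * y ^ (-c)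
        ≤ M * (1 + |v|) ^ n * Real.exp (π * |v| / 2) * Real.exp (c ^ 2 - v ^ 2) * y ^ (-c) := by
          gcongr; exact hM v
      _ = M * ((1 + |v|) ^ n * Real.exp (π * |v| / 2) * Real.exp (c ^ 2 - v ^ 2)) * y ^ (-c) := by
          ring
      _ ≤ M * (Real.exp (c ^ 2 + ((n : ℝ) + 2) ^ 2 / 2) * Real.exp (-(v ^ 2 / 2))) * y ^ (-c) := by
          gcongr
      _ = _ := by ring
  -- the factor `1/u^k`
  have h2 : ‖(u ^ k)⁻¹‖ ≤ (|c| ^ k)⁻¹ := by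
    rcases hck with hk | hc
    · subst hk; simp
    · rw [norm_inv, norm_pow]
      have hcu : |c| ≤ ‖u‖ := by
        have := Complex.abs_re_le_norm u
        rwa [hure] at this
      have hc0 : 0 < |c| := abs_pos.2 hc
      exact inv_anti₀ (pow_pos hc0 k) (pow_le_pow_left₀ hc0.le hcu k)
  calc ‖h u * cexp (u ^ 2) * (y : ℂ) ^ (-u) / u ^ k‖
      = ‖h u * cexp (u ^ 2) * (y : ℂ) ^ (-u)‖ * ‖(u ^ k)⁻¹‖ := by
        rw [div_eq_mul_inv, norm_mul]
    _ ≤ M * Real.exp (c ^ 2 + ((n : ℝ) + 2) ^ 2 / 2) * Real.exp (-(v ^ 2 / 2)) * y ^ (-c) *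
          (|c| ^ k)⁻¹ := by
        gcongr
    _ = _ := by ring

/-- Continuity of `F_k` along the line `Re u = c` from continuity of `h` there (`k = 0` or
`c ≠ 0`) — measurability for the absolutely convergent integral (7.14).
[cite: ConreyIwaniec2002, Proposition 7.1 (7.14) (absolute convergence)] -/
theorem continuous_lineF {h : ℂ → ℂ} {c y : ℝ} {k : ℕ} (hy : 0 < y) (hck : k = 0 ∨ c ≠ 0)
    (hc : Continuous fun v : ℝ ↦ h ((c : ℂ) + v * I)) :
    Continuous fun v : ℝ ↦
      h ((c : ℂ) + v * I) * cexp (((c : ℂ) + v * I) ^ 2) * (y : ℂ) ^ (-((c : ℂ) + v * I)) /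
        ((c : ℂ) + v * I) ^ k := by
  have hl : Continuous fun v : ℝ ↦ (c : ℂ) + v * I := by fun_prop
  refine Continuous.div (by
    refine (hc.mul ?_).mul ?_
    · exact Complex.continuous_exp.comp (hl.pow 2)
    · refine Continuous.const_cpow hl.neg (Or.inl ?_)
      exact_mod_cast hy.ne') (hl.pow k) fun v ↦ ?_
  rcases hck with hk | hc0
  · subst hk; simp
  · apply pow_ne_zero
    intro h0
    have := congrArg Complex.re h0
    simp at this
    exact hc0 this

/-- **Absolute convergence** of `∫ F_k(c+iv) dv` for `h` of Stirling class on the line.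
[cite: ConreyIwaniec2002, Proposition 7.1 (7.14) (absolute convergence)] -/
theorem integrable_lineF {h : ℂ → ℂ} {c M y : ℝ} {n k : ℕ} (hy : 0 < y) (hck : k = 0 ∨ c ≠ 0)
    (hc : Continuous fun v : ℝ ↦ h ((c : ℂ) + v * I))
    (hM : ∀ v : ℝ, ‖h ((c : ℂ) + v * I)‖ ≤ M * (1 + |v|) ^ n * Real.exp (π * |v| / 2)) :
    Integrable fun v : ℝ ↦
      h ((c : ℂ) + v * I) * cexp (((c : ℂ) + v * I) ^ 2) * (y : ℂ) ^ (-((c : ℂ) + v * I)) /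
        ((c : ℂ) + v * I) ^ k := by
  refine Integrable.mono' ((integrable_exp_neg_sq_half).const_mul
      (M * Real.exp (c ^ 2 + ((n : ℝ) + 2) ^ 2 / 2) * y ^ (-c) / |c| ^ k))
    (continuous_lineF hy hck hc).aestronglyMeasurable
    (Filter.Eventually.of_forall fun v ↦ ?_)
  exact norm_lineF_le hy hck hM v

/-- **The line bound**: `‖∫ F_k(c+iv) dv‖ ≤ M e^{c² + (n+2)²/2} √(2π) · y^{−c} / |c|^k`.
[cite: ConreyIwaniec2002, Lemma 7.2 (7.16)–(7.17)] -/
theorem norm_integral_lineF_le {h : ℂ → ℂ} {c M y : ℝ} {n k : ℕ} (hy : 0 < y)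
    (hck : k = 0 ∨ c ≠ 0)
    (hM : ∀ v : ℝ, ‖h ((c : ℂ) + v * I)‖ ≤ M * (1 + |v|) ^ n * Real.exp (π * |v| / 2)) :
    ‖∫ v : ℝ, h ((c : ℂ) + v * I) * cexp (((c : ℂ) + v * I) ^ 2) * (y : ℂ) ^ (-((c : ℂ) + v * I)) /
        ((c : ℂ) + v * I) ^ k‖ ≤
      M * Real.exp (c ^ 2 + ((n : ℝ) + 2) ^ 2 / 2) * Real.sqrt (2 * π) * y ^ (-c) / |c| ^ k := by
  have h := norm_integral_le_of_norm_le ((integrable_exp_neg_sq_half).const_mul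
      (M * Real.exp (c ^ 2 + ((n : ℝ) + 2) ^ 2 / 2) * y ^ (-c) / |c| ^ k))
    (Filter.Eventually.of_forall (norm_lineF_le (h := h) hy hck hM))
  refine h.trans (le_of_eq ?_)
  rw [integral_const_mul, integral_exp_neg_sq_half]
  ring

/-! ### Holomorphy and horizontal decay on a strip -/

/-- `u ↦ G(u) y^{−u} = e^{u²} y^{−u}` is entire (`y > 0`) — "`G(u)` is a suitable holomorphic
function". [cite: ConreyIwaniec2002, §7 (7.9) (G holomorphic)] -/
theorem differentiable_cexp_sq_mul_cpow {y : ℝ} (hy : 0 < y) :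
    Differentiable ℂ fun u : ℂ ↦ cexp (u ^ 2) * (y : ℂ) ^ (-u) := by
  intro u
  refine ((differentiableAt_id.pow 2).cexp).mul ?_
  have h : HasDerivAt (fun u : ℂ ↦ (y : ℂ) ^ (-u)) _ u :=
    (hasDerivAt_neg u).const_cpow (Or.inl (by exact_mod_cast hy.ne'))
  exact h.differentiableAt

/-- `y^{−x} ≤ y^{−a} + y^{−b}` for `x ∈ [a, b]`, `y > 0`. [folklore] -/
private theorem rpow_neg_le_add {y a b x : ℝ} (hy : 0 < y) (hx : x ∈ Icc a b) :
    y ^ (-x) ≤ y ^ (-a) + y ^ (-b) := by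
  have ha0 : 0 ≤ y ^ (-a) := (Real.rpow_pos_of_pos hy _).le
  have hb0 : 0 ≤ y ^ (-b) := (Real.rpow_pos_of_pos hy _).le
  rcases le_or_gt 1 y with h1 | h1
  · have : y ^ (-x) ≤ y ^ (-a) := Real.rpow_le_rpow_of_exponent_le h1 (by linarith [hx.1])
    linarith
  · have : y ^ (-x) ≤ y ^ (-b) :=
      Real.rpow_le_rpow_of_exponent_ge hy h1.le (by linarith [hx.2])
    linarith

/-- Uniform bound for `F_k` on the horizontal segments `[a,b] + iT`, `|T| ≥ 1`, for `h` of Stirling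
class on the strip. [folklore] -/
private theorem norm_lineF_horizontal_le {h : ℂ → ℂ} {a b M y : ℝ} {n k : ℕ} (hy : 0 < y)
    (hM : ∀ u : ℂ, a ≤ u.re → u.re ≤ b → ‖h u‖ ≤ M * (1 + |u.im|) ^ n * Real.exp (π * |u.im| / 2))
    {T : ℝ} (hT : 1 ≤ |T|) {x : ℝ} (hx : x ∈ Icc a b) :
    ‖h ((x : ℂ) + T * I) * cexp (((x : ℂ) + T * I) ^ 2) * (y : ℂ) ^ (-((x : ℂ) + T * I)) /
        ((x : ℂ) + T * I) ^ k‖ ≤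
      M * Real.exp (a ^ 2 + b ^ 2 + ((n : ℝ) + 2) ^ 2 / 2) * (y ^ (-a) + y ^ (-b)) *
        Real.exp (-(T ^ 2 / 2)) := by
  have hMx : ∀ v : ℝ, ‖h ((x : ℂ) + v * I)‖ ≤ M * (1 + |v|) ^ n * Real.exp (π * |v| / 2) := by
    intro v
    have := hM ((x : ℂ) + v * I) (by simp [hx.1]) (by simp [hx.2])
    simpa using this
  have hM0 : 0 ≤ M := by
    have := (norm_nonneg _).trans (hMx 0)
    simpa using this
  -- first the bound with `k = 0` on the line `Re u = x`
  have h0 := norm_lineF_le (h := h) (k := 0) (n := n) hy (Or.inl rfl) hMx T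
  simp only [pow_zero, div_one] at h0
  -- `1/‖u^k‖ ≤ 1` as `‖u‖ ≥ |T| ≥ 1`
  set u : ℂ := (x : ℂ) + T * I with hu
  have hu1 : 1 ≤ ‖u‖ := by
    have := Complex.abs_im_le_norm u
    simp [hu] at this
    exact hT.trans this
  have hk : ‖(u ^ k)⁻¹‖ ≤ 1 := by
    rw [norm_inv, norm_pow]
    exact inv_le_one_of_one_le₀ (one_le_pow₀ hu1)
  have hexp : Real.exp (x ^ 2 + ((n : ℝ) + 2) ^ 2 / 2) ≤
      Real.exp (a ^ 2 + b ^ 2 + ((n : ℝ) + 2) ^ 2 / 2) := by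
    apply Real.exp_le_exp.2
    have : x ^ 2 ≤ a ^ 2 + b ^ 2 := by
      rcases le_or_gt 0 x with h | h
      · nlinarith [hx.2]
      · nlinarith [hx.1]
    linarith
  have hyx := rpow_neg_le_add hy hx
  calc ‖h u * cexp (u ^ 2) * (y : ℂ) ^ (-u) / u ^ k‖
      = ‖h u * cexp (u ^ 2) * (y : ℂ) ^ (-u)‖ * ‖(u ^ k)⁻¹‖ := by rw [div_eq_mul_inv, norm_mul]
    _ ≤ M * Real.exp (x ^ 2 + ((n : ℝ) + 2) ^ 2 / 2) * y ^ (-x) * Real.exp (-(T ^ 2 / 2)) * 1 := by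
        gcongr
    _ ≤ M * Real.exp (a ^ 2 + b ^ 2 + ((n : ℝ) + 2) ^ 2 / 2) * (y ^ (-a) + y ^ (-b)) *
          Real.exp (-(T ^ 2 / 2)) := by
        rw [mul_one]
        gcongr

/-- The horizontal decay hypothesis of the contour-shift lemmas, for `F_k` with `h` of Stirling
class on the strip `a ≤ Re u ≤ b` (the horizontal sides vanish in the limit because `G` decays
like a Gaussian on vertical lines). [cite: ConreyIwaniec2002, Lemma 7.2 (proof, moving the line)] -/
theorem lineF_decay {h : ℂ → ℂ} {a b M y : ℝ} {n k : ℕ} (hy : 0 < y)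
    (hM : ∀ u : ℂ, a ≤ u.re → u.re ≤ b → ‖h u‖ ≤ M * (1 + |u.im|) ^ n * Real.exp (π * |u.im| / 2)) :
    ∀ ε : ℝ, 0 < ε → ∃ T₀ : ℝ, ∀ T : ℝ, T₀ ≤ |T| → ∀ x ∈ Icc a b,
      ‖h ((x : ℂ) + T * I) * cexp (((x : ℂ) + T * I) ^ 2) * (y : ℂ) ^ (-((x : ℂ) + T * I)) /
        ((x : ℂ) + T * I) ^ k‖ ≤ ε := by
  refine Literature.Analysis.Complex.decay_of_bound (T₀ := 1)
    (g := fun t ↦ M * Real.exp (a ^ 2 + b ^ 2 + ((n : ℝ) + 2) ^ 2 / 2) * (y ^ (-a) + y ^ (-b)) *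
      Real.exp (-(t ^ 2 / 2)))
    (F := fun u ↦ h u * cexp (u ^ 2) * (y : ℂ) ^ (-u) / u ^ k) ?_ ?_
  · intro T hT x hx
    have := norm_lineF_horizontal_le (k := k) hy hM hT hx
    simpa [sq_abs] using this
  · have h1 : Tendsto (fun t : ℝ ↦ -(t ^ 2 / 2)) atTop atBot := by
      have : Tendsto (fun t : ℝ ↦ t ^ 2 / 2) atTop atTop :=
        (tendsto_pow_atTop two_ne_zero).atTop_div_const (by norm_num)
      exact tendsto_neg_atTop_atBot.comp this
    have h2 := Real.tendsto_exp_atBot.comp h1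
    have h3 := h2.const_mul (M * Real.exp (a ^ 2 + b ^ 2 + ((n : ℝ) + 2) ^ 2 / 2) *
      (y ^ (-a) + y ^ (-b)))
    simpa using h3

/-! ### Shifting the line of integration -/

/-- **Shift across a pole-free strip.** If `h` is holomorphic on `a ≤ Re u ≤ b` and of Stirling
class there, and either `k = 0` or `0 ∉ [a, b]`, then `∫ F_k(a+iv) dv = ∫ F_k(b+iv) dv`.
[cite: ConreyIwaniec2002, Lemma 7.2 (proof, moving the integration to the line Re u = A)] -/
theorem integral_lineF_eq_of_noPole {h : ℂ → ℂ} {a b M y : ℝ} {n k : ℕ} (hab : a ≤ b)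
    (hy : 0 < y) (hk : k = 0 ∨ b < 0 ∨ 0 < a)
    (hd : DifferentiableOn ℂ h (re ⁻¹' Icc a b))
    (hM : ∀ u : ℂ, a ≤ u.re → u.re ≤ b → ‖h u‖ ≤ M * (1 + |u.im|) ^ n * Real.exp (π * |u.im| / 2)) :
    (∫ v : ℝ, h ((a : ℂ) + v * I) * cexp (((a : ℂ) + v * I) ^ 2) * (y : ℂ) ^ (-((a : ℂ) + v * I)) /
        ((a : ℂ) + v * I) ^ k) =
      ∫ v : ℝ, h ((b : ℂ) + v * I) * cexp (((b : ℂ) + v * I) ^ 2) * (y : ℂ) ^ (-((b : ℂ) + v * I)) /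
        ((b : ℂ) + v * I) ^ k := by
  have hka : k = 0 ∨ a ≠ 0 := by
    rcases hk with h | h | h
    · exact Or.inl h
    · exact Or.inr (by linarith)
    · exact Or.inr (by linarith)
  have hkb : k = 0 ∨ b ≠ 0 := by
    rcases hk with h | h | h
    · exact Or.inl h
    · exact Or.inr (by linarith)
    · exact Or.inr (by linarith)
  have hcont : ∀ c ∈ Icc a b, Continuous fun v : ℝ ↦ h ((c : ℂ) + v * I) := by
    intro c hc
    have hl : Continuous fun v : ℝ ↦ (c : ℂ) + v * I := by fun_prop
    refine (hd.continuousOn.comp_continuous hl fun v ↦ ?_)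
    simpa using hc
  have hMl : ∀ c ∈ Icc a b, ∀ v : ℝ,
      ‖h ((c : ℂ) + v * I)‖ ≤ M * (1 + |v|) ^ n * Real.exp (π * |v| / 2) := by
    intro c hc v
    have := hM ((c : ℂ) + v * I) (by simp [hc.1]) (by simp [hc.2])
    simpa using this
  refine Literature.Analysis.Complex.integral_vertical_eq_of_differentiableOn
    (F := fun u ↦ h u * cexp (u ^ 2) * (y : ℂ) ^ (-u) / u ^ k) hab ?_
    (integrable_lineF hy hka (hcont a (left_mem_Icc.2 hab)) (hMl a (left_mem_Icc.2 hab)))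
    (integrable_lineF hy hkb (hcont b (right_mem_Icc.2 hab)) (hMl b (right_mem_Icc.2 hab)))
    (lineF_decay hy hM)
  -- differentiability on the strip
  intro u hu
  have hu' : a ≤ u.re ∧ u.re ≤ b := by simpa using hu
  have h1 : DifferentiableWithinAt ℂ (fun u ↦ h u * (cexp (u ^ 2) * (y : ℂ) ^ (-u)))
      (re ⁻¹' Icc a b) u :=
    (hd u hu).mul ((differentiable_cexp_sq_mul_cpow hy) u).differentiableWithinAt
  have h1' : DifferentiableWithinAt ℂ (fun u ↦ h u * cexp (u ^ 2) * (y : ℂ) ^ (-u))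
      (re ⁻¹' Icc a b) u := by
    simpa only [mul_assoc] using h1
  refine h1'.div ((differentiableAt_id.pow k).differentiableWithinAt) ?_
  rcases hk with h0 | h0 | h0
  · subst h0; simp
  · apply pow_ne_zero; intro hz; rw [hz] at hu'; simp at hu'; linarith
  · apply pow_ne_zero; intro hz; rw [hz] at hu'; simp at hu'; linarith

/-- **Shift across the simple pole at `u = 0`** (`k = 1`, `a < 0 < b`): for `h` holomorphic on the
strip `a ≤ Re u ≤ b` and of Stirling class there,
`∫ F₁(b+iv) dv − ∫ F₁(a+iv) dv = 2π h(0)` (the residue of `h(u)e^{u²}y^{−u}/u` at `0` is `h(0)`).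
[cite: ConreyIwaniec2002, Lemma 7.2 (proof, the simple pole at u = 0 with residue 1)] -/
theorem integral_lineF_one_sub_eq {h : ℂ → ℂ} {a b M y : ℝ} {n : ℕ} (ha : a < 0) (hb : 0 < b)
    (hy : 0 < y) (hd : DifferentiableOn ℂ h (re ⁻¹' Icc a b))
    (hM : ∀ u : ℂ, a ≤ u.re → u.re ≤ b → ‖h u‖ ≤ M * (1 + |u.im|) ^ n * Real.exp (π * |u.im| / 2)) :
    (∫ v : ℝ, h ((b : ℂ) + v * I) * cexp (((b : ℂ) + v * I) ^ 2) * (y : ℂ) ^ (-((b : ℂ) + v * I)) /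
        ((b : ℂ) + v * I)) -
      (∫ v : ℝ, h ((a : ℂ) + v * I) * cexp (((a : ℂ) + v * I) ^ 2) * (y : ℂ) ^ (-((a : ℂ) + v * I)) /
        ((a : ℂ) + v * I)) = 2 * π * h 0 := by
  have hab : a ≤ b := (ha.trans hb).le
  have hcont : ∀ c ∈ Icc a b, Continuous fun v : ℝ ↦ h ((c : ℂ) + v * I) := by
    intro c hc
    have hl : Continuous fun v : ℝ ↦ (c : ℂ) + v * I := by fun_prop
    refine (hd.continuousOn.comp_continuous hl fun v ↦ ?_)
    simpa using hc
  have hMl : ∀ c ∈ Icc a b, ∀ v : ℝ,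
      ‖h ((c : ℂ) + v * I)‖ ≤ M * (1 + |v|) ^ n * Real.exp (π * |v| / 2) := by
    intro c hc v
    have := hM ((c : ℂ) + v * I) (by simp [hc.1]) (by simp [hc.2])
    simpa using this
  -- the numerator `H(u) = h(u) e^{u²} y^{-u}`
  set H : ℂ → ℂ := fun u ↦ h u * cexp (u ^ 2) * (y : ℂ) ^ (-u) with hH
  have hHd : DifferentiableOn ℂ H (Icc a b ×ℂ univ) := by
    intro u hu
    have hu' : u ∈ re ⁻¹' Icc a b := by
      simpa [Complex.mem_reProdIm] using hu
    have h1 : DifferentiableWithinAt ℂ (fun u ↦ h u * (cexp (u ^ 2) * (y : ℂ) ^ (-u)))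
        (re ⁻¹' Icc a b) u :=
      (hd u hu').mul ((differentiable_cexp_sq_mul_cpow hy) u).differentiableWithinAt
    have hset : Icc a b ×ℂ univ = re ⁻¹' Icc a b := by
      ext z; simp [Complex.mem_reProdIm]
    rw [hset]
    simpa only [hH, mul_assoc] using h1
  have hinta := integrable_lineF (k := 1) hy (Or.inr ha.ne) (hcont a (left_mem_Icc.2 hab))
    (hMl a (left_mem_Icc.2 hab))
  have hintb := integrable_lineF (k := 1) hy (Or.inr hb.ne') (hcont b (right_mem_Icc.2 hab))
    (hMl b (right_mem_Icc.2 hab))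
  simp only [pow_one] at hinta hintb
  have hdec := lineF_decay (k := 1) hy hM
  have key := HuxleyZeroDetection.integral_vertical_sub_eq_of_pole H 0 (a := a) (b := b)
    (by simpa using ha) (by simpa using hb) hHd
    (by simpa [hH, sub_zero] using hinta) (by simpa [hH, sub_zero] using hintb)
    (by
      intro ε hε
      obtain ⟨T₀, hT₀⟩ := hdec ε hε
      refine ⟨T₀, fun σ hσ T hT ↦ ?_⟩
      have := hT₀ T hT σ hσ
      simpa [hH, sub_zero, pow_one] using this)
  have hH0 : H 0 = h 0 := by simp [hH]
  simpa [hH, sub_zero, hH0] using key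

end AFEKernel

end ConreyIwaniec2002

end Literature.NumberTheory.LFunctions

end
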